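import Literature.Analysis.FunctionSpaces.BesselITuranSharp
import Literature.Analysis.FunctionSpaces.BesselIDerivative
import Mathlib.Analysis.Calculus.Deriv.MeanValue
import HarnessLib

/-!
# The Bessel quotient `x ↦ I_{n+2}(x)/I_{n+1}(x)` is STRICTLY INCREASING on `(0, ∞)`; the Turánian
# `I_{n+1}² − I_n I_{n+2}` strictly DECREASES with the order

Topic `Literature/Analysis/FunctionSpaces`, a proofs sibling of `BesselITuranSharp.lean` (the explicit
Turánian `D_n(x) := I_{n+1}(x)² − I_n(x) I_{n+2}(x) = Σ_k t_k(n)`,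
`t_k(n) = (x/2)^{2(k+n+1)} C(2(k+n+1),k)/((k+n+1)!(k+n+2)!)`) and `BesselIDerivative.lean`
(`I_{n+1}' = (I_n + I_{n+2})/2`, DLMF 10.29.1).  For the integral-defined `besselI` of `BesselMoments.lean`:

* `besselI_sq_sub_mul_succ_lt` — **`D_{n+1}(x) < D_n(x)` for `x ≠ 0`** (termwise: `t_k(n+1) ≤ t_{k+1}(n)`
  because `C(2j,k) ≤ C(2j,k+1)` below the middle, and `t_0(n) > 0` is left over);
* `hasDerivAt_besselI_succ_two_div` — **`(I_{n+2}/I_{n+1})'(x) = (D_n(x) − D_{n+1}(x)) / (2 I_{n+1}(x)²)`**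
  for `x > 0` (quotient rule + the derivative relation: the numerator
  `(I_{n+1}+I_{n+3})I_{n+1} − I_{n+2}(I_n+I_{n+2})` IS `D_n − D_{n+1}`);
* ★ `strictMonoOn_besselI_succ_two_div` — **`x ↦ I_{n+2}(x)/I_{n+1}(x)` is strictly increasing on
  `(0, ∞)`** for every `n ∈ ℕ` (the classical monotonicity of the Bessel quotient `r_ν = I_{ν+1}/I_ν`,
  here `ν = n + 1 ≥ 1`; the case `ν = 0`, `I₁/I₀`, and the case `ν = 1` by a Schwinger–Dyson argument are
  already in the tree as `Summit.Ventures.LatticeQCDFlow.Scoring.monotone_onePlaquetteExpect(U1|SU2)_cos`,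
  non-strict), and the two-step quotient `strictMonoOn_besselI_add_three_div_succ`
  (`x ↦ I_{n+3}(x)/I_{n+1}(x)`), in particular `I₂/I₁` and `I₃/I₁` — the fundamental and adjoint SU(2)
  one-plaquette character ratios `u(β)`, `a₁(β)` — are strictly increasing in `β > 0`.

Everything is proved; no definition, no named fact.  NOT here: non-integer order; the limits
`r_ν(x) → 1` (`x → ∞`); concavity of `r_ν`.

## References

* Á. Baricz, *Turán type inequalities for modified Bessel functions*, Bull. Aust. Math. Soc. 82 (2010)
  254–264, Theorem 2.1 and the remark after it ("the function `ν ↦ I_{ν+a}(u)/I_ν(u)` is decreasing …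
  `ν ↦ I_ν(u)` is log-concave"). [Baricz2010TuranBessel]
* J. Segura, *Bounds for ratios of modified Bessel functions and associated Turán-type inequalities*,
  J. Math. Anal. Appl. 374 (2011) 516–528, §2 (the Riccati equation of `r_ν = I_{ν+1}/I_ν` and its
  monotonic bounds). [Segura2011]
* NIST DLMF 10.29.1 (derivative relation). [DLMF]
-/

noncomputable section

open Finset Set
open scoped BigOperators Nat

namespace Literature.Analysis.FunctionSpaces

variable {x : ℝ}

/-- Termwise comparison behind the order-monotonicity of the Turánian: `t_k(n+1) ≤ t_{k+1}(n)`, i.e.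
`C(2(k+n+2), k) ≤ C(2(k+n+2), k+1)` (binomial coefficients increase below the middle).
[cite: Baricz2010TuranBessel, Theorem 2.1 (proof, termwise Turánian)] -/
theorem turanTerm_succ_order_le (n : ℕ) (x : ℝ) (k : ℕ) :
    (x / 2) ^ (2 * (k + (n + 1) + 1)) * (((2 * (k + (n + 1) + 1)).choose k : ℕ) : ℝ) /
        (((k + (n + 1) + 1)! : ℝ) * ((k + (n + 1) + 2)! : ℝ)) ≤
      (x / 2) ^ (2 * (k + 1 + n + 1)) * (((2 * (k + 1 + n + 1)).choose (k + 1) : ℕ) : ℝ) /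
        (((k + 1 + n + 1)! : ℝ) * ((k + 1 + n + 2)! : ℝ)) := by
  have e1 : k + (n + 1) + 1 = k + n + 2 := by ring
  have e2 : k + (n + 1) + 2 = k + n + 3 := by ring
  have e3 : k + 1 + n + 1 = k + n + 2 := by ring
  have e4 : k + 1 + n + 2 = k + n + 3 := by ring
  rw [e1, e2, e3, e4]
  have hpow : 0 ≤ (x / 2) ^ (2 * (k + n + 2)) := by rw [pow_mul]; positivity
  have hC : (((2 * (k + n + 2)).choose k : ℕ) : ℝ) ≤ (((2 * (k + n + 2)).choose (k + 1) : ℕ) : ℝ) := by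
    exact_mod_cast Nat.choose_le_succ_of_lt_half_left (by omega)
  exact div_le_div_of_nonneg_right (mul_le_mul_of_nonneg_left hC hpow) (by positivity)

/-- **The Turánian strictly decreases with the order**: for `x ≠ 0` and every `n ∈ ℕ`,
`I_{n+2}(x)² − I_{n+1}(x) I_{n+3}(x) < I_{n+1}(x)² − I_n(x) I_{n+2}(x)` (equivalently, by the derivative
relation, the Bessel quotient `I_{n+2}/I_{n+1}` has positive derivative).
[cite: Baricz2010TuranBessel, Theorem 2.1 (explicit Turánian; ν ↦ I_ν log-concave remark)] -/
theorem besselI_sq_sub_mul_succ_lt (n : ℕ) (hx : x ≠ 0) :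
    besselI (n + 2) x ^ 2 - besselI (n + 1) x * besselI (n + 3) x <
      besselI (n + 1) x ^ 2 - besselI n x * besselI (n + 2) x := by
  have hn := hasSum_besselI_sq_sub_mul n x
  have hn1 := hasSum_besselI_sq_sub_mul (n + 1) x
  -- shift the order-`n` series by one term
  have hshift := (hasSum_nat_add_iff' 1).mpr hn
  simp only [Finset.sum_range_one] at hshift
  have hle := hasSum_le (turanTerm_succ_order_le n x) hn1 hshift
  have h0 := turanTerm_pos n hx 0
  have e : n + 1 + 2 = n + 3 := by ring
  rw [e] at hle
  simp only [zero_add] at h0 hle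
  linarith

/-- **Derivative of the Bessel quotient**: for `x` with `I_{n+1}(x) ≠ 0` (e.g. `x > 0`),
`(I_{n+2}/I_{n+1})'(x) = (D_n(x) − D_{n+1}(x)) / (2·I_{n+1}(x)²)` with `D_m = I_{m+1}² − I_m I_{m+2}`.
[cite: DLMF, 10.29.1] -/
theorem hasDerivAt_besselI_succ_two_div (n : ℕ) (hI : besselI (n + 1) x ≠ 0) :
    HasDerivAt (fun y => besselI (n + 2) y / besselI (n + 1) y)
      (((besselI (n + 1) x ^ 2 - besselI n x * besselI (n + 2) x) -
          (besselI (n + 2) x ^ 2 - besselI (n + 1) x * besselI (n + 3) x)) /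
        (2 * besselI (n + 1) x ^ 2)) x := by
  have h : HasDerivAt (fun y => besselI (n + 2) y / besselI (n + 1) y)
      (((besselI (n + 1) x + besselI (n + 3) x) / 2 * besselI (n + 1) x -
          besselI (n + 2) x * ((besselI n x + besselI (n + 2) x) / 2)) / besselI (n + 1) x ^ 2) x :=
    (hasDerivAt_besselI_succ (n + 1) x).div (hasDerivAt_besselI_succ n x) hI
  refine h.congr_deriv ?_
  field_simp
  ring

/-- ★ **The Bessel quotient `x ↦ I_{n+2}(x)/I_{n+1}(x)` is strictly increasing on `(0, ∞)`**, every
`n ∈ ℕ`. [cite: Segura2011, §2 (Riccati equation of r_ν = I_{ν+1}/I_ν; monotone bounds)] -/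
theorem strictMonoOn_besselI_succ_two_div (n : ℕ) :
    StrictMonoOn (fun y : ℝ => besselI (n + 2) y / besselI (n + 1) y) (Ioi 0) := by
  have hpos : ∀ {y : ℝ}, 0 < y → ∀ m : ℕ, 0 < besselI m y := fun hy m => by
    rw [besselI_eq_latticeModels_besselI]
    exact Literature.Probability.LatticeModels.besselI_pos hy _
  refine strictMonoOn_of_deriv_pos (convex_Ioi 0) ?_ ?_
  · intro y hy
    exact (hasDerivAt_besselI_succ_two_div n (hpos hy (n + 1)).ne').continuousAt.continuousWithinAt
  · intro y hy
    rw [interior_Ioi] at hy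
    rw [(hasDerivAt_besselI_succ_two_div n (hpos hy (n + 1)).ne').deriv]
    exact div_pos (sub_pos.2 (besselI_sq_sub_mul_succ_lt n hy.ne'))
      (mul_pos two_pos (pow_pos (hpos hy (n + 1)) 2))

/-- For `0 < x < y`: `I_{n+2}(x)/I_{n+1}(x) < I_{n+2}(y)/I_{n+1}(y)`.
[cite: Segura2011, §2 (monotonicity of the Bessel quotient)] -/
theorem besselI_succ_two_div_lt_of_lt (n : ℕ) {x y : ℝ} (hx : 0 < x) (hxy : x < y) :
    besselI (n + 2) x / besselI (n + 1) x < besselI (n + 2) y / besselI (n + 1) y :=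
  strictMonoOn_besselI_succ_two_div n hx (hx.trans hxy) hxy

/-- **The two-step quotient `x ↦ I_{n+3}(x)/I_{n+1}(x)` is strictly increasing on `(0, ∞)`** (product of two
positive strictly increasing quotients); at `n = 0` this is the adjoint SU(2) character ratio `I₃/I₁`.
[cite: Segura2011, §2 (monotonicity of the Bessel quotient)] -/
theorem strictMonoOn_besselI_add_three_div_succ (n : ℕ) :
    StrictMonoOn (fun y : ℝ => besselI (n + 3) y / besselI (n + 1) y) (Ioi 0) := by
  have hpos : ∀ {y : ℝ}, 0 < y → ∀ m : ℕ, 0 < besselI m y := fun hy m => by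
    rw [besselI_eq_latticeModels_besselI]
    exact Literature.Probability.LatticeModels.besselI_pos hy _
  intro a ha b hb hab
  have ha' : (0 : ℝ) < a := ha
  have hb' : (0 : ℝ) < b := hb
  have h1 := strictMonoOn_besselI_succ_two_div n ha hb hab
  have h2 := strictMonoOn_besselI_succ_two_div (n + 1) ha hb hab
  simp only at h1 h2
  have ea : besselI (n + 3) a / besselI (n + 1) a =
      (besselI (n + 1 + 2) a / besselI (n + 1 + 1) a) * (besselI (n + 2) a / besselI (n + 1) a) := by
    rw [show n + 1 + 2 = n + 3 by ring, show n + 1 + 1 = n + 2 by ring]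
    field_simp [(hpos ha' (n + 1)).ne', (hpos ha' (n + 2)).ne']
  have eb : besselI (n + 3) b / besselI (n + 1) b =
      (besselI (n + 1 + 2) b / besselI (n + 1 + 1) b) * (besselI (n + 2) b / besselI (n + 1) b) := by
    rw [show n + 1 + 2 = n + 3 by ring, show n + 1 + 1 = n + 2 by ring]
    field_simp [(hpos hb' (n + 1)).ne', (hpos hb' (n + 2)).ne']
  simp only
  rw [ea, eb]
  have p1 : 0 < besselI (n + 1 + 2) a / besselI (n + 1 + 1) a := div_pos (hpos ha' _) (hpos ha' _)
  have p2 : 0 < besselI (n + 2) a / besselI (n + 1) a := div_pos (hpos ha' _) (hpos ha' _)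
  exact mul_lt_mul h2 h1.le p2 (p1.trans h2).le

/-- The fundamental SU(2) ratio: `x ↦ I₂(x)/I₁(x)` is strictly increasing on `(0, ∞)` (the strict form of the
tree's `Summit.Ventures.LatticeQCDFlow.Scoring.monotone_besselI_two_div_besselI_one`).
[cite: Segura2011, §2 (monotonicity of the Bessel quotient)] -/
theorem strictMonoOn_besselI_two_div_one : StrictMonoOn (fun y : ℝ => besselI 2 y / besselI 1 y) (Ioi 0) :=
  strictMonoOn_besselI_succ_two_div 0

/-- The adjoint SU(2) ratio: `x ↦ I₃(x)/I₁(x)` is strictly increasing on `(0, ∞)`.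
[cite: Segura2011, §2 (monotonicity of the Bessel quotient)] -/
theorem strictMonoOn_besselI_three_div_one : StrictMonoOn (fun y : ℝ => besselI 3 y / besselI 1 y) (Ioi 0) :=
  strictMonoOn_besselI_add_three_div_succ 0

end Literature.Analysis.FunctionSpaces
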